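import Literature.AnabelianGeometry.AbsoluteAnabelian.AbsTopIChainsCuspidalAlgorithmFamily
import HarnessLib

/-!
# [AbsTopI] Lemma 4.5 (v) as typed (`CuspidalAlgorithm.RecoversCusps`) — HEAD-MATCHED INSTANCE FORMS
# (FACT-LIST row F-0206), PROOF-ONLY

S. Mochizuki, *Topics in Absolute Anabelian Geometry I: Generalities*, J. Math. Sci. Univ. Tokyo **19** (2012)
139–242, Lemma 4.5 (v) p. 55: "the set of cusps … is in natural bijective correspondence with the set of
conjugacy classes … of decomposition groups of cusps [as described in (iv)] … In particular, by allowing `H` to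
vary, this yields a ["group-theoretic"] characterization of the decomposition groups of cusps in `Π`"
[cite: MochizukiAbsTopI2012, Lemma 4.5 (v) p.55].

PROOF-ONLY companion of `AbsTopIChains.lean` (cell abc-iut, block F, seat abc-iut-f-020, KEY INST59A; FROZEN
FACT-LIST row F-0206 `FundamentalExtension.CuspidalAlgorithm.RecoversCusps`; 0 `def`, 0 `instance`, 0 `structure`;
nothing restated).  The row is a SCHEMA over a free functorial cuspidal algorithm `A` and free cuspidal data `C`
(model-relative predicate: "the algorithm's output on `E` is exactly the set of decomposition groups of cusps of
`C`"); its universal closure is false (abc-iut-f-060, `AbsTopIChainsCuspidalFacts`: `exists_not_recoversCusps`,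
`not_forall_recoversCusps` — `C` must be THE cusp data of the curve), and the positive evidence of record consists
of `iff`-criteria and ∃-packages (`recoversCusps_iff_out_eq_empty_of_isEmpty`, `exists_recoversCusps_iff`,
`exists_recoversCusps_forall_isEmpty`, …), so no theorem of the tree has `RecoversCusps` as its conclusion HEAD.
This file supplies the head-matched forms of the PROPER (cusp-less) case, "nothing to recover": (1) the
conditional closer — an algorithm with empty output on `E` recovers the cusps of every cusp-less cuspidal datum on
`E`; (2) the unconditional instance at THE empty functorial algorithm of record
(`CuspidalAlgorithm.exists_recoversCusps_forall_isEmpty`, named by `Exists.choose`), for EVERY extension `E` and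
EVERY cusp-less `C`; (3) the definitional closer from the output equation.

HONEST LABEL: the proper case only; the affine case (an algorithm recovering the cusps of a hyperbolic curve from
`Δ ⊆ Π`, print's content via Lemma 4.5 (iii)–(iv)) is not constructed in the tree.  Statements about OUR typed
predicate; nothing here bears on [IUTchIII] Cor. 3.12 or takes a side on any author; typed ≠ proved.
-/

namespace Literature.AnabelianGeometry.AbsoluteAnabelian

open scoped Pointwise

universe u

namespace FundamentalExtension

/-- **F-0206, definitional closer**: an algorithm whose output on `E` IS the union of the conjugacy classes of
the decomposition groups of the cusps of `C` recovers the cusps of `(E, C)` (the typed predicate, by name).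
[cite: MochizukiAbsTopI2012, Lemma 4.5 (v) p.55] -/
theorem CuspidalAlgorithm.recoversCusps_of_out_eq (A : CuspidalAlgorithm.{u}) (E : FundamentalExtension.{u})
    (C : CuspidalData E) (h : A.out E = ⋃ x : C.Cusp, C.decompositionClass x) : A.RecoversCusps E C :=
  h

/-- **F-0206, conditional closer (the proper case)**: an algorithm with EMPTY output on `E` recovers the cusps
of every cusp-less cuspidal datum `C` on `E` — [AbsTopI] Lemma 4.5 (v) for proper curves, where there is
nothing to recover (`recoversCusps_iff_out_eq_empty_of_isEmpty`). [cite: MochizukiAbsTopI2012, Lemma 4.5 (v) p.55] -/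
theorem CuspidalAlgorithm.recoversCusps_of_out_eq_empty (A : CuspidalAlgorithm.{u})
    (E : FundamentalExtension.{u}) (C : CuspidalData E) [IsEmpty C.Cusp] (hA : A.out E = ∅) :
    A.RecoversCusps E C :=
  (CuspidalAlgorithm.recoversCusps_iff_out_eq_empty_of_isEmpty A E C).mpr hA

/-- **F-0206, unconditional instance at THE empty functorial algorithm of record**: the algorithm of
`CuspidalAlgorithm.exists_recoversCusps_forall_isEmpty` (output `∅` on every extension — closed,
conjugation-stable and transported vacuously; named by `Exists.choose`) recovers the cusps of EVERY cusp-less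
cuspidal datum `C` on EVERY extension `E`; in particular at the genuine proper surface-group models of the
Lem 4.5 (i) census. [cite: MochizukiAbsTopI2012, Lemma 4.5 (v) p.55] -/
theorem CuspidalAlgorithm.recoversCusps_emptyAlgorithm (E : FundamentalExtension.{u}) (C : CuspidalData E)
    [hC : IsEmpty C.Cusp] :
    CuspidalAlgorithm.RecoversCusps CuspidalAlgorithm.exists_recoversCusps_forall_isEmpty.{u}.choose E C :=
  CuspidalAlgorithm.exists_recoversCusps_forall_isEmpty.{u}.choose_spec E C hC

end FundamentalExtension

end Literature.AnabelianGeometry.AbsoluteAnabelian
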